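import Summits.Parity.BatemanHorn.Theorems.AlmostPrimeZerosSystemLSDRealSegmentNairClassFourPrep
import HarnessLib

/-!
# Nair–Tenenbaum light, IXb: class IV slices (reduction to the `c`-sum, main term, remainder)

Crux `SystemLSDRealSegment` (stmt-Parity-11292, route `AlmostPrimeZeros`), line `beta-thinned-root-kernel`,
support programme of the lead c8: **Nair–Tenenbaum "light"** — the sharp-order upper bound
`Σ_{1≤n≤N} G(F(n)) ≤ C · N · exp(Σ_{p≤N} (G(p) − 1) ρ_F(p)/p)` for a polynomial `F ∈ ℤ[X]` (degree `≥ 1`, positive on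
`ℕ_{≥1}`, root counts `ρ_F(p) ≤ D`, `ρ_F(p) < p`, `ρ_F(p^a) ≤ M`) and every weight `G ≥ 0`, `G(1) = 1`, multiplicative on
coprime arguments with `G(p^v) ≤ A` (M. Nair, Acta Arith. 62 (1992); Nair–Tenenbaum, Acta Math. 180 (1998), Thm 1 —
the special case of the class bounded at prime powers), by Shiu's method (J. reine angew. Math. 313 (1980), §5) run on the
values `m = F(n)`: cut `m = c·d` at `√N` (`Shiu.cutPrime/cPart/dPart`), four classes, the beta upper-bound sieve of dimension
`2D` on the root classes of `c`, Hall–Tenenbaum's Theorem 01 and Rankin's trick with a uniform exponent for the `c`-sums.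
Applied (file `…NairUpperBound`) to the product polynomial of a Bateman–Horn system with `G = y^{capped}` it gives
`Σ_{n≤x} y^{s_f(n)} ≪ x (log x)^{k(y−1)}`, i.e. `H_x(y) = O(1)` on the real segment — the upper half of the order of
magnitude predicted by the crux (lower half: `sumPowStat_lower_bound`, landed).  Everything here is PROVED; no definitions.

This file: `class4_slice` (slice `r` ≤ `A^{(r+1)B₂} Σ_{C_r} G(c)·#T_r(c)`), `class4_main_r` (Mertens window + Rankin with the uniform exponent: `≤ K (r+1)^D e^{−r} N e^{ΣGρ/p}e^{−Σρ/p}`), `class4_rem_r` (`≤ K N^{7/8} e^{(D+AD) log log N}`), and `Σ_r e^{−r/2} ≤ 3`.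
-/

open Finset Real Polynomial

namespace Summit.Parity.BatemanHorn.Cruxes.SystemLSDRealSegment.BetaThinnedRootKernel.Nair

open Literature.NumberTheory.Sieve

noncomputable section

section Main

variable {F : ℤ[X]} {D M : ℕ} {A : ℝ}

/-- `Σ_{r ∈ s} e^{−r/2} ≤ 3` for any finite set of naturals. [folklore] -/
theorem sum_exp_neg_half_le (s : Finset ℕ) : ∑ r ∈ s, Real.exp (-((r : ℝ) / 2)) ≤ 3 := by
  set q : ℝ := Real.exp (-(1 / 2 : ℝ)) with hq
  have hq0 : 0 ≤ q := Real.exp_nonneg _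
  have hq1 : q < 1 := Real.exp_lt_one_iff.2 (by norm_num)
  have hq2 : q ≤ 2 / 3 := by
    -- `e^{-1/2} ≤ 2/3` iff `3/2 ≤ e^{1/2}`; `e^{1/2} ≥ 1 + 1/2`
    have h1 : (3 / 2 : ℝ) ≤ Real.exp (1 / 2) := by have := Real.add_one_le_exp (1 / 2 : ℝ); linarith
    rw [hq, Real.exp_neg, inv_le_comm₀ (Real.exp_pos _) (by norm_num)]
    linarith
  have hterm : ∀ r : ℕ, Real.exp (-((r : ℝ) / 2)) = q ^ r := by
    intro r
    rw [hq, ← Real.exp_nat_mul]; ring_nf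
  have hsum : Summable (fun r : ℕ => q ^ r) := summable_geometric_of_lt_one hq0 hq1
  calc ∑ r ∈ s, Real.exp (-((r : ℝ) / 2)) = ∑ r ∈ s, q ^ r := Finset.sum_congr rfl fun r _ => hterm r
    _ ≤ ∑' r : ℕ, q ^ r := hsum.sum_le_tsum s fun r _ => pow_nonneg hq0 r
    _ = (1 - q)⁻¹ := tsum_geometric_of_lt_one hq0 hq1
    _ ≤ 3 := by
        rw [inv_le_comm₀ (by linarith) (by norm_num)]
        linarith

/-- **Class IV, slice `r`**: the `n` with `⌊log z₀/log P⌋ = r` are grouped by their smooth part `c`: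
`Σ_{slice r} G(F(n)) ≤ A^{(r+1)B₂} Σ_{c ∈ C_r} G(c) · #{n ≤ N : c ∣ F(n), (F(n), P_c(w_r)) = 1}`. [folklore] -/
theorem class4_slice (hpos : ∀ n : ℕ, 1 ≤ n → 0 < F.eval (n : ℤ))
    {G : ℕ → ℝ} (hG0 : ∀ n, 0 ≤ G n) (hG1 : G 1 = 1) (hGmul : ∀ m n : ℕ, m.Coprime n → G (m * n) = G m * G n)
    (hGA : ∀ p : ℕ, p.Prime → ∀ v : ℕ, 1 ≤ v → G (p ^ v) ≤ A) (hA : 1 ≤ A)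
    {N : ℕ} (hN1 : 1 ≤ N) (hNH : (∑ j ∈ range (F.natDegree + 1), (F.coeff j).natAbs) * 2 ^ F.natDegree ≤ N)
    {e₀ B₂ z₀ logL L : ℝ} (he₀0 : 0 < e₀) (hz₀ : z₀ = (N : ℝ) ^ e₀) (hB₂ : B₂ = ((F.natDegree : ℝ) + 1) / e₀)
    (hlogLeq : Real.log L = logL) (hlogLpos : 0 < logL) (hL0 : 0 < L) (r : ℕ) :
    ∑ n ∈ ((Icc 1 N).filter (fun n : ℕ => Real.sqrt N < (F.eval (n : ℤ)).toNat ∧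
        (Shiu.cutPrime (Real.sqrt N) (F.eval (n : ℤ)).toNat : ℝ) < z₀ ∧
        (N : ℝ) ^ (1 / 4 : ℝ) < (Shiu.cPart (Real.sqrt N) (F.eval (n : ℤ)).toNat : ℝ) ∧
        L < (Shiu.cutPrime (Real.sqrt N) (F.eval (n : ℤ)).toNat : ℝ))).filter
        (fun n : ℕ => ⌊Real.log z₀ / Real.log (Shiu.cutPrime (Real.sqrt N) (F.eval (n : ℤ)).toNat)⌋₊ = r),
        G (F.eval (n : ℤ)).toNat ≤
      A ^ (((r : ℝ) + 1) * B₂) * ∑ c ∈ (Icc 1 ⌊Real.sqrt N⌋₊).filter (fun c : ℕ =>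
          (N : ℝ) ^ (1 / 4 : ℝ) < (c : ℝ) ∧ ∀ p ∈ c.primeFactors, (p : ℝ) < z₀ ^ (1 / (r : ℝ))),
        G c * #((Icc 1 N).filter (fun n' : ℕ => (c : ℤ) ∣ F.eval (n' : ℤ) ∧
          ∀ p ∈ Nat.primesBelow ⌈z₀ ^ (1 / ((r : ℝ) + 1))⌉₊, ¬ p ∣ c → ¬ (p : ℤ) ∣ F.eval (n' : ℤ))) := by
  set S := (Icc 1 N).filter (fun n : ℕ => Real.sqrt N < (F.eval (n : ℤ)).toNat ∧
      (Shiu.cutPrime (Real.sqrt N) (F.eval (n : ℤ)).toNat : ℝ) < z₀ ∧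
      (N : ℝ) ^ (1 / 4 : ℝ) < (Shiu.cPart (Real.sqrt N) (F.eval (n : ℤ)).toNat : ℝ) ∧
      L < (Shiu.cutPrime (Real.sqrt N) (F.eval (n : ℤ)).toNat : ℝ)) with hS
  set rf : ℕ → ℕ := fun n => ⌊Real.log z₀ / Real.log (Shiu.cutPrime (Real.sqrt N) (F.eval (n : ℤ)).toNat)⌋₊
    with hrf
  set cf : ℕ → ℕ := fun n => Shiu.cPart (Real.sqrt N) (F.eval (n : ℤ)).toNat with hcf
  set Tset : ℕ → Finset ℕ := fun c => (Icc 1 N).filter fun n' : ℕ => (c : ℤ) ∣ F.eval (n' : ℤ) ∧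
      ∀ p ∈ Nat.primesBelow ⌈z₀ ^ (1 / ((r : ℝ) + 1))⌉₊, ¬ p ∣ c → ¬ (p : ℤ) ∣ F.eval (n' : ℤ) with hTset
  set Cr : Finset ℕ := (Icc 1 ⌊Real.sqrt N⌋₊).filter fun c : ℕ =>
      (N : ℝ) ^ (1 / 4 : ℝ) < (c : ℝ) ∧ ∀ p ∈ c.primeFactors, (p : ℝ) < z₀ ^ (1 / (r : ℝ)) with hCr
  have hAr : 0 ≤ A ^ (((r : ℝ) + 1) * B₂) := (Real.rpow_pos_of_pos (by linarith) _).le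
  set Sr := S.filter (fun n => rf n = r) with hSr
  have hSrfacts : ∀ n ∈ Sr, G (F.eval (n : ℤ)).toNat ≤ A ^ (((r : ℝ) + 1) * B₂) * G (cf n) ∧
      n ∈ Tset (cf n) ∧ cf n ∈ Cr := by
    intro n hn
    rw [hSr, Finset.mem_filter] at hn
    obtain ⟨hnS, hnr⟩ := hn
    obtain ⟨-, -, h1, h2, h3⟩ := class4_pointwise hpos hG0 hG1 hGmul hGA hA hN1 hNH he₀0 hz₀ hB₂ hlogLeq hlogLpos hL0 hnS
    simp only [hrf] at hnr
    rw [hnr] at h1 h2 h3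
    exact ⟨h1, h2, h3⟩
  show ∑ n ∈ Sr, G (F.eval (n : ℤ)).toNat ≤ A ^ (((r : ℝ) + 1) * B₂) * ∑ c ∈ Cr, G c * #(Tset c)
  calc ∑ n ∈ Sr, G (F.eval (n : ℤ)).toNat ≤ ∑ n ∈ Sr, A ^ (((r : ℝ) + 1) * B₂) * G (cf n) :=
        Finset.sum_le_sum fun n hn => (hSrfacts n hn).1
    _ = A ^ (((r : ℝ) + 1) * B₂) * ∑ n ∈ Sr, G (cf n) := by rw [Finset.mul_sum]
    _ = A ^ (((r : ℝ) + 1) * B₂) * ∑ c ∈ Sr.image cf, (#(Sr.filter fun n => cf n = c) : ℝ) * G c := by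
        rw [Finset.sum_comp]; simp only [nsmul_eq_mul]
    _ ≤ A ^ (((r : ℝ) + 1) * B₂) * ∑ c ∈ Sr.image cf, G c * #(Tset c) := by
        refine mul_le_mul_of_nonneg_left (Finset.sum_le_sum fun c hc => ?_) hAr
        rw [mul_comm]
        refine mul_le_mul_of_nonneg_left ?_ (hG0 c)
        exact_mod_cast Finset.card_le_card fun n hn => by
          rw [Finset.mem_filter] at hn
          rw [← hn.2]; exact (hSrfacts n hn.1).2.1
    _ ≤ A ^ (((r : ℝ) + 1) * B₂) * ∑ c ∈ Cr, G c * #(Tset c) := by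
        refine mul_le_mul_of_nonneg_left (Finset.sum_le_sum_of_subset_of_nonneg ?_ ?_) hAr
        · intro c hc
          rw [Finset.mem_image] at hc
          obtain ⟨n, hn, rfl⟩ := hc
          exact (hSrfacts n hn).2.2
        · intro c _ _; exact mul_nonneg (hG0 c) (Nat.cast_nonneg _)

/-- **Class IV, main term of slice `r`.** With `V(w_r) ≤ K₅ ((r+1)/e₀)^D e^{−Σρ/p}` (Mertens window) and Rankin with
the uniform exponent `η_r = c′r/log z₀` on the `v_r`-smooth `c > N^{1/4}` (`Y^{−η_r} = A^{−rB₂} e^{−r}`, `v_r^{η_r} = e^{c′}`,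
`η_r(log v_r + log 4) ≤ 2c′`):
`A^{(r+1)B₂} · K₁ N V(w_r) Σ_{C_r} u(c)/c ≤ K₁K₅ e₀^{−D} A^{B₂} e^{K_r + 2c′e^{c′}ADΘ} · (r+1)^D e^{−r} · N · e^{Σ Gρ/p} e^{−Σ ρ/p}`.
[folklore] -/
theorem class4_main_r (hD : ∀ p : ℕ, p.Prime → polyRootCountMod ![F] p ≤ D)
    (hfix : ∀ p : ℕ, p.Prime → polyRootCountMod ![F] p < p)
    {G : ℕ → ℝ} (hG0 : ∀ n, 0 ≤ G n) (hA : 1 ≤ A)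
    {N : ℕ} (hN1 : 1 < N) {e₀ B₂ z₀ logL c' K₁ K₅ Kr : ℝ} (he₀0 : 0 < e₀) (he₀1 : e₀ ≤ 1) (hz₀ : z₀ = (N : ℝ) ^ e₀)
    (hz₀4 : (4 : ℝ) ≤ z₀) (hB₂0 : 0 ≤ B₂) (hc' : c' = 4 * e₀ * (B₂ * Real.log A + 1)) (hlogL2 : 2 ≤ logL)
    (hlogL3c : 3 * c' ≤ logL) (hK₁ : 0 ≤ K₁) (hK₅ : 0 ≤ K₅)
    (hV : ∀ w : ℝ, 2 ≤ w → w ≤ N → ∏ p ∈ Nat.primesBelow ⌈w⌉₊, (1 - (polyRootCountMod ![F] p : ℝ) / p) ≤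
      K₅ * (Real.log N / Real.log w) ^ D * Real.exp (-∑ p ∈ Nat.primesLE N, (polyRootCountMod ![F] p : ℝ) / p))
    (hKr : ∀ (v : ℝ), 2 ≤ v → ∀ η : ℝ, 0 < η → η ≤ 1 / 3 → ∀ Y : ℝ, 0 < Y →
      ∀ S : Finset ℕ, (∀ c ∈ S, c ≠ 0 ∧ Y < (c : ℝ) ∧ ∀ p ∈ c.primeFactors, (p : ℝ) < v) →
        ∑ c ∈ S, G c * polyRootCountMod ![F] c *
            (∏ p ∈ c.primeFactors, (p : ℝ) / ((p : ℝ) - polyRootCountMod ![F] p)) / c ≤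
          Y ^ (-η) * Real.exp (Kr + A * D * (4 * D + 2) * η * v ^ η * (Real.log v + Real.log 4) +
            ∑ p ∈ Nat.primesBelow ⌈v⌉₊, G p * polyRootCountMod ![F] p / p))
    {r : ℕ} (hr1 : 1 ≤ r) (hrR : r ≤ ⌊Real.log z₀ / logL⌋₊) :
    A ^ (((r : ℝ) + 1) * B₂) * (K₁ * N * (∏ p ∈ Nat.primesBelow ⌈z₀ ^ (1 / ((r : ℝ) + 1))⌉₊,
        (1 - (polyRootCountMod ![F] p : ℝ) / p)) *
      ∑ c ∈ (Icc 1 ⌊Real.sqrt N⌋₊).filter (fun c : ℕ =>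
          (N : ℝ) ^ (1 / 4 : ℝ) < (c : ℝ) ∧ ∀ p ∈ c.primeFactors, (p : ℝ) < z₀ ^ (1 / (r : ℝ))),
        G c * polyRootCountMod ![F] c * (∏ p ∈ c.primeFactors, (p : ℝ) / ((p : ℝ) - polyRootCountMod ![F] p)) / c) ≤
    K₁ * K₅ * (1 / e₀) ^ D * A ^ B₂ * Real.exp (Kr + A * D * (4 * D + 2) * (2 * c') * Real.exp c') *
      (((r : ℝ) + 1) ^ D * Real.exp (-(r : ℝ))) * N *
      (Real.exp (∑ p ∈ Nat.primesLE N, G p * polyRootCountMod ![F] p / p) *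
        Real.exp (-∑ p ∈ Nat.primesLE N, (polyRootCountMod ![F] p : ℝ) / p)) := by
  have hN0 : (0 : ℝ) < N := by exact_mod_cast (show 0 < N by omega)
  have hN1' : (1 : ℝ) < N := by exact_mod_cast hN1
  have hlogN : 0 < Real.log N := Real.log_pos hN1'
  have hz₀0 : 0 < z₀ := by linarith
  have hz₀N : z₀ ≤ N := by
    rw [hz₀]
    calc (N : ℝ) ^ e₀ ≤ (N : ℝ) ^ (1 : ℝ) := Real.rpow_le_rpow_of_exponent_le hN1'.le he₀1
      _ = N := Real.rpow_one _
  have hlogz₀ : Real.log z₀ = e₀ * Real.log N := by rw [hz₀, Real.log_rpow hN0]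
  have hlogz₀pos : 0 < Real.log z₀ := by rw [hlogz₀]; positivity
  have hlogLpos : 0 < logL := by linarith
  have hlogA : 0 ≤ Real.log A := Real.log_nonneg hA
  have hc'0 : 0 < c' := by rw [hc']; positivity
  obtain ⟨hw2, hwv, hvz, hlw, hlv, hη0, hη3, hrle⟩ := class4_rfacts hz₀4 hlogL2 hc'0 hlogL3c hr1 hrR
  set v : ℝ := z₀ ^ (1 / (r : ℝ)) with hvdef
  set w : ℝ := z₀ ^ (1 / ((r : ℝ) + 1)) with hwdef
  set η : ℝ := c' * r / Real.log z₀ with hηdef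
  set Y : ℝ := (N : ℝ) ^ (1 / 4 : ℝ) with hY
  have hY0 : 0 < Y := Real.rpow_pos_of_pos hN0 _
  have hr0 : (0 : ℝ) < r := by exact_mod_cast hr1
  have hwN : w ≤ N := hwv.trans (hvz.trans hz₀N)
  set Cr : Finset ℕ := (Icc 1 ⌊Real.sqrt N⌋₊).filter (fun c : ℕ =>
      Y < (c : ℝ) ∧ ∀ p ∈ c.primeFactors, (p : ℝ) < v) with hCr
  set EG : ℝ := Real.exp (∑ p ∈ Nat.primesLE N, G p * polyRootCountMod ![F] p / p) with hEG
  set Eρ : ℝ := Real.exp (-∑ p ∈ Nat.primesLE N, (polyRootCountMod ![F] p : ℝ) / p) with hEρ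
  -- `V(w_r)`
  have hV1 : ∏ p ∈ Nat.primesBelow ⌈w⌉₊, (1 - (polyRootCountMod ![F] p : ℝ) / p) ≤
      K₅ * (((r : ℝ) + 1) / e₀) ^ D * Eρ := by
    have := hV w hw2 hwN
    rwa [hlw, hlogz₀, show Real.log N / (e₀ * Real.log N / ((r : ℝ) + 1)) = ((r : ℝ) + 1) / e₀ by
      field_simp] at this
  -- Rankin on `Cr`
  have hRk := hKr v (hw2.trans hwv) η hη0 hη3 Y hY0 Cr (fun c hc => by
    rw [hCr] at hc
    simp only [Finset.mem_filter, Finset.mem_Icc] at hc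
    exact ⟨by omega, hc.2.1, hc.2.2⟩)
  -- evaluate the Rankin factor
  have hYη : Y ^ (-η) = Real.exp (-((r : ℝ) * B₂ * Real.log A)) * Real.exp (-(r : ℝ)) := by
    rw [hY, ← Real.rpow_mul hN0.le, Real.rpow_def_of_pos hN0, ← Real.exp_add]
    congr 1
    rw [hηdef, hlogz₀, hc']
    field_simp
    ring
  have hvη : v ^ η = Real.exp c' := by
    rw [hvdef, hηdef, ← Real.rpow_mul hz₀0.le, Real.rpow_def_of_pos hz₀0]
    congr 1
    field_simp
  have hηlog : η * (Real.log v + Real.log 4) ≤ 2 * c' := by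
    rw [hlv, hηdef]
    have h1 : c' * r / Real.log z₀ * (Real.log z₀ / r + Real.log 4) = c' + c' * (r / Real.log z₀) * Real.log 4 := by
      field_simp
    rw [h1]
    have h2 : (r : ℝ) / Real.log z₀ ≤ 1 / logL := by
      rw [div_le_div_iff₀ hlogz₀pos hlogLpos, one_mul]
      rw [le_div_iff₀ hlogLpos] at hrle; linarith
    have h3 : Real.log 4 ≤ 2 := by
      have : Real.log 4 = 2 * Real.log 2 := by
        rw [show (4 : ℝ) = 2 ^ 2 by norm_num, Real.log_pow]; ring
      rw [this]; have := Real.log_two_lt_d9; linarith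
    have h4 : c' * (r / Real.log z₀) * Real.log 4 ≤ c' * (1 / logL) * 2 := by gcongr
    have h5 : c' * (1 / logL) * 2 ≤ c' := by
      rw [show c' * (1 / logL) * 2 = c' * (2 / logL) by ring]
      refine mul_le_of_le_one_right hc'0.le ?_
      rw [div_le_one hlogLpos]; exact hlogL2
    linarith
  have hRk' : ∑ c ∈ Cr, G c * polyRootCountMod ![F] c *
        (∏ p ∈ c.primeFactors, (p : ℝ) / ((p : ℝ) - polyRootCountMod ![F] p)) / c ≤
      Real.exp (-((r : ℝ) * B₂ * Real.log A)) * Real.exp (-(r : ℝ)) *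
        (Real.exp (Kr + A * D * (4 * D + 2) * (2 * c') * Real.exp c') * EG) := by
    refine hRk.trans ?_
    rw [hYη]
    refine mul_le_mul_of_nonneg_left ?_ (by positivity)
    rw [← Real.exp_add]
    refine Real.exp_le_exp.2 ?_
    have h1 : A * D * (4 * D + 2) * η * v ^ η * (Real.log v + Real.log 4) ≤
        A * D * (4 * D + 2) * (2 * c') * Real.exp c' := by
      rw [hvη]
      have hADΘ : 0 ≤ A * D * (4 * D + 2) * Real.exp c' := by
        have : (0 : ℝ) ≤ A := by linarith
        positivity
      calc A * D * (4 * D + 2) * η * Real.exp c' * (Real.log v + Real.log 4)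
          = (A * D * (4 * D + 2) * Real.exp c') * (η * (Real.log v + Real.log 4)) := by ring
        _ ≤ (A * D * (4 * D + 2) * Real.exp c') * (2 * c') := mul_le_mul_of_nonneg_left hηlog hADΘ
        _ = A * D * (4 * D + 2) * (2 * c') * Real.exp c' := by ring
    have h2 := sum_Grho_div_mono (F := F) hG0 (primesBelow_ceil_subset_primesLE (hvz.trans hz₀N) :
      Nat.primesBelow ⌈v⌉₊ ⊆ Nat.primesLE N)
    linarith
  -- `A^{(r+1)B₂} · A^{-rB₂} = A^{B₂}`
  have hAA : A ^ (((r : ℝ) + 1) * B₂) * Real.exp (-((r : ℝ) * B₂ * Real.log A)) = A ^ B₂ := by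
    rw [Real.rpow_def_of_pos (by linarith), Real.rpow_def_of_pos (by linarith), ← Real.exp_add]
    congr 1; ring
  have hsum0 : 0 ≤ ∑ c ∈ Cr, G c * polyRootCountMod ![F] c *
      (∏ p ∈ c.primeFactors, (p : ℝ) / ((p : ℝ) - polyRootCountMod ![F] p)) / c :=
    Finset.sum_nonneg fun c _ => by
      have := hG0 c
      have := one_le_hLoc F hD hfix c
      positivity
  have hAr : 0 ≤ A ^ (((r : ℝ) + 1) * B₂) := (Real.rpow_pos_of_pos (by linarith) _).le
  calc A ^ (((r : ℝ) + 1) * B₂) * (K₁ * N * (∏ p ∈ Nat.primesBelow ⌈w⌉₊, (1 - (polyRootCountMod ![F] p : ℝ) / p)) *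
        ∑ c ∈ Cr, G c * polyRootCountMod ![F] c *
          (∏ p ∈ c.primeFactors, (p : ℝ) / ((p : ℝ) - polyRootCountMod ![F] p)) / c)
      ≤ A ^ (((r : ℝ) + 1) * B₂) * (K₁ * N * (K₅ * (((r : ℝ) + 1) / e₀) ^ D * Eρ) *
        (Real.exp (-((r : ℝ) * B₂ * Real.log A)) * Real.exp (-(r : ℝ)) *
          (Real.exp (Kr + A * D * (4 * D + 2) * (2 * c') * Real.exp c') * EG))) := by
        gcongr
    _ = K₁ * K₅ * (1 / e₀) ^ D * (A ^ (((r : ℝ) + 1) * B₂) * Real.exp (-((r : ℝ) * B₂ * Real.log A))) *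
        Real.exp (Kr + A * D * (4 * D + 2) * (2 * c') * Real.exp c') *
        (((r : ℝ) + 1) ^ D * Real.exp (-(r : ℝ))) * N * (EG * Eρ) := by
        rw [div_pow, div_pow, one_pow]; ring
    _ = _ := by rw [hAA]

/-- **Class IV, remainder of slice `r`**: `w_r^{18D+1} ≤ z₀^{18D+1} = N^{1/4}`, `(log w_r)^D ≤ (log N)^D`,
`A^{(r+1)B₂} ≤ A^{B₂} N^{1/8}` (`logL ≥ 8(d+1)log A`), so the slice remainder is
`≤ A^{B₂} K₂ e^{AM+4AD} N^{7/8} e^{(D+AD) log log N}`. [folklore] -/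
theorem class4_rem_r (hA : 1 ≤ A) {N : ℕ} (hN1 : 1 < N) {e₀ B₂ z₀ logL c' K₂ : ℝ}
    (he₀ : e₀ = 1 / (4 * (18 * (D : ℝ) + 1))) (hz₀ : z₀ = (N : ℝ) ^ e₀) (hz₀4 : (4 : ℝ) ≤ z₀) (hB₂0 : 0 ≤ B₂)
    (hB₂ : B₂ = ((F.natDegree : ℝ) + 1) / e₀) (hc'0 : 0 < c') (hlogL2 : 2 ≤ logL) (hlogL3c : 3 * c' ≤ logL)
    (hlogL8 : 8 * ((F.natDegree : ℝ) + 1) * Real.log A ≤ logL) (hK₂ : 0 < K₂) {M : ℕ}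
    {r : ℕ} (hr1 : 1 ≤ r) (hrR : r ≤ ⌊Real.log z₀ / logL⌋₊) :
    A ^ (((r : ℝ) + 1) * B₂) * (K₂ * (z₀ ^ (1 / ((r : ℝ) + 1))) ^ (18 * D + 1) * Real.log (z₀ ^ (1 / ((r : ℝ) + 1))) ^ D *
      (Real.sqrt N * Real.exp (A * M + A * D * (Real.log (Real.log N) + 4)))) ≤
    A ^ B₂ * K₂ * Real.exp (A * M + A * D * 4) *
      ((N : ℝ) ^ (7 / 8 : ℝ) * Real.exp ((D + A * D) * Real.log (Real.log N))) := by
  have hN0 : (0 : ℝ) < N := by exact_mod_cast (show 0 < N by omega)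
  have hN1' : (1 : ℝ) < N := by exact_mod_cast hN1
  have hlogN : 0 < Real.log N := Real.log_pos hN1'
  have hz₀0 : 0 < z₀ := by linarith
  have hD0 : (0 : ℝ) < 18 * (D : ℝ) + 1 := by positivity
  have he₀0 : 0 < e₀ := by rw [he₀]; positivity
  have he₀1 : e₀ ≤ 1 := by
    rw [he₀, div_le_one (by positivity)]; nlinarith
  have hz₀N : z₀ ≤ N := by
    rw [hz₀]
    calc (N : ℝ) ^ e₀ ≤ (N : ℝ) ^ (1 : ℝ) := Real.rpow_le_rpow_of_exponent_le hN1'.le he₀1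
      _ = N := Real.rpow_one _
  have hlogz₀ : Real.log z₀ = e₀ * Real.log N := by rw [hz₀, Real.log_rpow hN0]
  have hlogLpos : 0 < logL := by linarith
  obtain ⟨hw2, hwv, hvz, hlw, hlv, hη0, hη3, hrle⟩ := class4_rfacts hz₀4 hlogL2 hc'0 hlogL3c hr1 hrR
  set w : ℝ := z₀ ^ (1 / ((r : ℝ) + 1)) with hwdef
  set ℓ : ℝ := Real.log (Real.log N) with hℓ
  have hwz : w ≤ z₀ := hwv.trans hvz
  have hw0 : 0 ≤ w := by linarith
  -- `w^E ≤ z₀^E = N^{1/4}`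
  have hzE : z₀ ^ (18 * D + 1) = (N : ℝ) ^ (1 / 4 : ℝ) := by
    rw [hz₀, ← Real.rpow_natCast, ← Real.rpow_mul hN0.le]
    congr 1
    rw [he₀]; push_cast; field_simp
  have hwE : w ^ (18 * D + 1) ≤ (N : ℝ) ^ (1 / 4 : ℝ) := by
    rw [← hzE]; exact pow_le_pow_left₀ hw0 hwz _
  -- `(log w)^D ≤ exp(D ℓ)`
  have hlwD : Real.log w ^ D ≤ Real.exp (D * ℓ) := by
    rw [Real.exp_nat_mul, hℓ, Real.exp_log hlogN]
    exact pow_le_pow_left₀ (Real.log_nonneg (by linarith)) (Real.log_le_log (by linarith) (hwz.trans hz₀N)) D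
  -- `A^{(r+1)B₂} ≤ A^{B₂} N^{1/8}`
  have hArB : A ^ (((r : ℝ) + 1) * B₂) ≤ A ^ B₂ * (N : ℝ) ^ (1 / 8 : ℝ) := by
    have hlogA : 0 ≤ Real.log A := Real.log_nonneg hA
    have h1 : (r : ℝ) * B₂ * Real.log A ≤ Real.log N / 8 := by
      calc (r : ℝ) * B₂ * Real.log A ≤ (Real.log z₀ / logL) * B₂ * Real.log A := by gcongr
        _ = (((F.natDegree : ℝ) + 1) * Real.log A / logL) * Real.log N := by rw [hlogz₀, hB₂]; field_simp
        _ ≤ (1 / 8) * Real.log N := by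
            refine mul_le_mul_of_nonneg_right ?_ hlogN.le
            rw [div_le_iff₀ hlogLpos]; linarith
        _ = Real.log N / 8 := by ring
    calc A ^ (((r : ℝ) + 1) * B₂) = A ^ B₂ * Real.exp ((r : ℝ) * B₂ * Real.log A) := by
          rw [Real.rpow_def_of_pos (by linarith), Real.rpow_def_of_pos (by linarith), ← Real.exp_add]
          congr 1; ring
      _ ≤ A ^ B₂ * Real.exp (Real.log N / 8) := by gcongr
      _ = A ^ B₂ * (N : ℝ) ^ (1 / 8 : ℝ) := by rw [Real.rpow_def_of_pos hN0]; ring_nf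
  have hsqrt : Real.sqrt N = (N : ℝ) ^ (1 / 2 : ℝ) := Real.sqrt_eq_rpow _
  have h1 : Real.exp (A * M + A * D * (ℓ + 4)) = Real.exp (A * M + A * D * 4) * Real.exp (A * D * ℓ) := by
    rw [← Real.exp_add]; ring_nf
  have h78 : (N : ℝ) ^ (1 / 8 : ℝ) * ((N : ℝ) ^ (1 / 4 : ℝ) * (N : ℝ) ^ (1 / 2 : ℝ)) = (N : ℝ) ^ (7 / 8 : ℝ) := by
    rw [← Real.rpow_add hN0, ← Real.rpow_add hN0]; norm_num
  have h3 : Real.exp (D * ℓ) * Real.exp (A * D * ℓ) = Real.exp ((D + A * D) * ℓ) := by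
    rw [← Real.exp_add]; ring_nf
  have hlw0 : 0 ≤ Real.log w := Real.log_nonneg (by linarith)
  have hin : K₂ * w ^ (18 * D + 1) * Real.log w ^ D ≤ K₂ * (N : ℝ) ^ (1 / 4 : ℝ) * Real.exp (D * ℓ) :=
    mul_le_mul (mul_le_mul_of_nonneg_left hwE hK₂.le) hlwD (pow_nonneg hlw0 _) (by positivity)
  have hnn : 0 ≤ K₂ * w ^ (18 * D + 1) * Real.log w ^ D * (Real.sqrt N * Real.exp (A * M + A * D * (ℓ + 4))) :=
    mul_nonneg (mul_nonneg (mul_nonneg hK₂.le (pow_nonneg hw0 _)) (pow_nonneg hlw0 _)) (by positivity)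
  calc A ^ (((r : ℝ) + 1) * B₂) * (K₂ * w ^ (18 * D + 1) * Real.log w ^ D *
        (Real.sqrt N * Real.exp (A * M + A * D * (ℓ + 4))))
      ≤ (A ^ B₂ * (N : ℝ) ^ (1 / 8 : ℝ)) * (K₂ * (N : ℝ) ^ (1 / 4 : ℝ) * Real.exp (D * ℓ) *
        (Real.sqrt N * Real.exp (A * M + A * D * (ℓ + 4)))) :=
        mul_le_mul hArB (mul_le_mul_of_nonneg_right hin (by positivity)) hnn (by positivity)
    _ = A ^ B₂ * K₂ * Real.exp (A * M + A * D * 4) *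
        (((N : ℝ) ^ (1 / 8 : ℝ) * ((N : ℝ) ^ (1 / 4 : ℝ) * (N : ℝ) ^ (1 / 2 : ℝ))) *
          (Real.exp (D * ℓ) * Real.exp (A * D * ℓ))) := by rw [hsqrt, h1]; ring
    _ = _ := by rw [h78, h3]

end Main

/-- **Registered form** (`--supports stmt-Parity-11292`): the geometric bound `Σ_{r ∈ s} e^{−r/2} ≤ 3`. [folklore] -/
theorem nair_sum_exp_neg_half_le : ∀ s : Finset ℕ, ∑ r ∈ s, Real.exp (-((r : ℝ) / 2)) ≤ 3 :=
  fun s => sum_exp_neg_half_le s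

end

end Summit.Parity.BatemanHorn.Cruxes.SystemLSDRealSegment.BetaThinnedRootKernel.Nair
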